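import Mathlib
import Summits.KontsevichZagierPeriods.Zeta5Search.RVFlatGaugeLargeParam
import Summits.KontsevichZagierPeriods.Zeta5Search.ClassExpBoundProof
import HarnessLib

/-!
# RVLargeParamHighIneq — the shape of the high band of the bonus regime (fam-rv gen 9, file 9; #9.6a)

HONEST FRAMING: systematic search; no irrationality claim unless certified.  Pure parameter inequalities (no `p`-adics, no
classes) behind the PROOF of the high-band node `LargeParamHighBandPos` of file 8 (`RVLargeParamZCoverBonus.lean`), completed in
file 10 (`RVLargeParamZCoverHigh.lean`).  Setting: the large-parameter regime — `b` in the polytope, a designated slot `i`, every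
other block SHORT (`b₀ − 2b_k < p` for `k ≠ i`).  Write `N = N_p(b)` (pair floors), `d = d(b)`, `nbig = #{k : b_k ≥ p}`.

* SUM LEMMA (`units_of_dLarge`): if `2p ≤ d` and some `b_a ≥ p` with `a ≠ i`, then EVERY `k ∉ {i, a}` has `p ≤ b₀ − b_i − b_k`
  (else `Σ_k b_k ≥ p + (b₀ − b_i − p + 1) + b_i + 2(b₀ − p + 1) = 3b₀ − 2p + 3 > 3b₀ − d`).  Hence `2p ≤ d ∧ nbig ≥ 1 ⇒ N ≥ 5`
  (`five_le_pairFloors_of_dLarge`) and `2p ≤ d ∧ nbig ≥ 2 ⇒ N ≥ 6` (`six_le_pairFloors_of_dLarge`); a big designated parameter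
  `b_i ≥ p` is incompatible with `2p ≤ d` (`not_big_designated`).
* HIGH-BAND SHAPE (`highBand_shape`): `1 ≤ lpBonus(b,p)` and `−3 ≤ −N + lpBonus` force `lpBonus = 1`, `N ≤ 4` and `[LP] = 1`; and
  `[LP] = 1` hands out the LP PARTNER (`lp_partner`): the designated block is long (`p ≤ b₀ − 2b_i`) and some `k ≠ i` has `b_k ≥ p`,
  `b₀ − b_i − b_k ≥ p`.
Integer bookkeeping only; nothing about irrationality.
-/

noncomputable section

open Finset

namespace Summit.KontsevichZagierPeriods.Zeta5Search.ClusterValuation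

open Summit.KontsevichZagierPeriods.Zeta5Search.DualSeries (InBox)
open Summit.KontsevichZagierPeriods.Zeta5Search.WedgeDictionary (dOf)
open Summit.KontsevichZagierPeriods.Zeta5Search.CasoratianValuation (InPolytope pairFloors)
open Summit.KontsevichZagierPeriods.Zeta5Search.RVFlatGauge.Cap (nbig lpUnit lpBonus lpUnit_nonneg lpUnit_le_one lpBonus_nonneg)

variable {p : ℕ}

/-! ### Stars and units of the pair floors -/

/-- A sub-star of the pair floors: `Σ_{k ∈ S} ⌊(b₀ − b_i − b_k)/p⌋ ≤ N_p` for `S ⊆ {0..6} ∖ i`. -/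
theorem substar_le_pairFloors (b : ℕ → ℤ) (hb : InPolytope b) (p : ℕ) {i : ℕ} (hi : i ∈ range 7) {S : Finset ℕ}
    (hS : S ⊆ (range 7).erase i) : ∑ k ∈ S, pairTerm b p i k ≤ pairFloors b p := by
  have h1 := pairSum_erase b p hi
  have h2 := pairSum_nonneg b hb p (S := (range 7).erase i) (erase_subset _ _)
  have h3 : ∑ k ∈ S, pairTerm b p i k ≤ ∑ k ∈ (range 7).erase i, pairTerm b p i k :=
    sum_le_sum_of_subset_of_nonneg hS fun k hk _ =>
      pairTerm_nonneg b hb p (mem_range.1 hi) (mem_range.1 (mem_erase.1 hk).2)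
  rw [pairSum_range] at h1
  linarith

/-- A unit: `p ≤ b₀ − b_i − b_k ⇒ 1 ≤ ⌊(b₀ − b_i − b_k)/p⌋`. -/
theorem one_le_pairTerm (b : ℕ → ℤ) (hp : 0 < p) {i k : ℕ} (h : (p : ℤ) ≤ b 0 - b (i + 1) - b (k + 1)) :
    1 ≤ pairTerm b p i k := by
  unfold pairTerm
  rw [Int.le_ediv_iff_mul_le (by exact_mod_cast hp)]
  linarith

/-- Units on a set: if every `k ∈ S ⊆ {0..6} ∖ i` has `p ≤ b₀ − b_i − b_k` then `#S ≤ N_p`. -/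
theorem card_le_pairFloors_of_units (b : ℕ → ℤ) (hb : InPolytope b) (hp : 0 < p) {i : ℕ} (hi : i ∈ range 7)
    {S : Finset ℕ} (hS : S ⊆ (range 7).erase i) (hu : ∀ k ∈ S, (p : ℤ) ≤ b 0 - b (i + 1) - b (k + 1)) :
    (S.card : ℤ) ≤ pairFloors b p := by
  have h1 : (S.card : ℤ) = ∑ k ∈ S, (1 : ℤ) := by simp
  rw [h1]
  exact (sum_le_sum fun k hk => one_le_pairTerm b hp (hu k hk)).trans (substar_le_pairFloors b hb p hi hS)

/-! ### The sum lemma -/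

/-- Short blocks: `b₀ − p + 1 ≤ 2b_k` for `k ≠ i`. -/
theorem two_mul_ge_of_short (b : ℕ → ℤ) {i : ℕ} (hshort : ∀ k ∈ (range 7).erase i, b 0 - 2 * b (k + 1) < p)
    {k : ℕ} (hk : k ∈ (range 7).erase i) : b 0 - p + 1 ≤ 2 * b (k + 1) := by
  have := hshort k hk; omega

/-- **SUM LEMMA:** `2p ≤ d`, `b_a ≥ p` (`a ≠ i`) and short blocks force `p ≤ b₀ − b_i − b_k` for every `k ∉ {i, a}`. -/
theorem units_of_dLarge (b : ℕ → ℤ) {i a : ℕ} (hi : i ∈ range 7) (ha : a ∈ (range 7).erase i)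
    (hshort : ∀ k ∈ (range 7).erase i, b 0 - 2 * b (k + 1) < p) (hβa : (p : ℤ) ≤ b (a + 1))
    (hd : 2 * (p : ℤ) ≤ dOf b) : ∀ k ∈ ((range 7).erase i).erase a, (p : ℤ) ≤ b 0 - b (i + 1) - b (k + 1) := by
  intro k hk
  by_contra hlt
  push Not at hlt
  have hka : k ∈ (range 7).erase i := mem_of_mem_erase hk
  set R := (((range 7).erase i).erase a).erase k with hR
  have hcard : R.card = 4 := by
    rw [hR, card_erase_of_mem hk, card_erase_of_mem ha, card_erase_of_mem hi]; rfl
  have hRshort : ∀ j ∈ R, b 0 - p + 1 ≤ 2 * b (j + 1) := fun j hj =>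
    two_mul_ge_of_short b hshort (mem_of_mem_erase (mem_of_mem_erase hj))
  have hRsum : (4 : ℤ) * (b 0 - p + 1) ≤ ∑ j ∈ R, 2 * b (j + 1) := by
    have h := card_nsmul_le_sum R (fun j => 2 * b (j + 1)) (b 0 - p + 1) hRshort
    rw [hcard] at h
    simpa using h
  have hsplit : ∑ j ∈ range 7, b (j + 1) = b (i + 1) + (b (a + 1) + (b (k + 1) + ∑ j ∈ R, b (j + 1))) := by
    rw [← add_sum_erase _ _ hi, ← add_sum_erase _ _ ha, ← add_sum_erase _ _ hk]
  have h2 : ∑ j ∈ R, 2 * b (j + 1) = 2 * ∑ j ∈ R, b (j + 1) := by rw [mul_sum]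
  have hd' : dOf b = 3 * b 0 - ∑ j ∈ range 7, b (j + 1) := rfl
  linarith

/-- **A big designated parameter `b_i ≥ p` is incompatible with `2p ≤ d`** (short blocks elsewhere). -/
theorem not_big_designated (b : ℕ → ℤ) {i : ℕ} (hi : i ∈ range 7)
    (hshort : ∀ k ∈ (range 7).erase i, b 0 - 2 * b (k + 1) < p) (hβi : (p : ℤ) ≤ b (i + 1))
    (hd : 2 * (p : ℤ) ≤ dOf b) : False := by
  set R := (range 7).erase i with hR
  have hcard : R.card = 6 := by rw [hR, card_erase_of_mem hi]; rfl
  have hRsum : (6 : ℤ) * (b 0 - p + 1) ≤ ∑ j ∈ R, 2 * b (j + 1) := by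
    have h := card_nsmul_le_sum R (fun j => 2 * b (j + 1)) (b 0 - p + 1) fun j hj => two_mul_ge_of_short b hshort hj
    rw [hcard] at h
    simpa using h
  have hsplit : ∑ j ∈ range 7, b (j + 1) = b (i + 1) + ∑ j ∈ R, b (j + 1) := by rw [← add_sum_erase _ _ hi]
  have h2 : ∑ j ∈ R, 2 * b (j + 1) = 2 * ∑ j ∈ R, b (j + 1) := by rw [mul_sum]
  have hd' : dOf b = 3 * b 0 - ∑ j ∈ range 7, b (j + 1) := rfl
  linarith

/-- A big lower parameter, read off `nbig ≥ 1`. -/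
theorem exists_big_of_nbig (b : ℕ → ℤ) (h : 1 ≤ nbig b p) : ∃ a ∈ range 7, (p : ℤ) ≤ b (a + 1) := by
  obtain ⟨a, ha⟩ := card_pos.1 (by unfold nbig at h; omega :
    0 < (univ.filter fun k : Fin 7 => (p : ℤ) ≤ b (k.val + 1)).card)
  exact ⟨a.val, mem_range.2 a.isLt, (mem_filter.1 ha).2⟩

/-- Two big lower parameters, read off `nbig ≥ 2`. -/
theorem exists_two_big_of_nbig (b : ℕ → ℤ) (h : 2 ≤ nbig b p) :
    ∃ a ∈ range 7, ∃ a' ∈ range 7, a ≠ a' ∧ (p : ℤ) ≤ b (a + 1) ∧ (p : ℤ) ≤ b (a' + 1) := by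
  obtain ⟨a, ha, a', ha', hne⟩ := one_lt_card.1 (by unfold nbig at h; omega :
    1 < (univ.filter fun k : Fin 7 => (p : ℤ) ≤ b (k.val + 1)).card)
  exact ⟨a.val, mem_range.2 a.isLt, a'.val, mem_range.2 a'.isLt, fun e => hne (Fin.ext e),
    (mem_filter.1 ha).2, (mem_filter.1 ha').2⟩

/-- **`2p ≤ d ∧ nbig ≥ 1 ⇒ N_p ≥ 5`.** -/
theorem five_le_pairFloors_of_dLarge (b : ℕ → ℤ) (hb : InPolytope b) (hp : 0 < p) {i : ℕ} (hi : i ∈ range 7)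
    (hshort : ∀ k ∈ (range 7).erase i, b 0 - 2 * b (k + 1) < p) (hd : 2 * (p : ℤ) ≤ dOf b) (hn : 1 ≤ nbig b p) :
    5 ≤ pairFloors b p := by
  obtain ⟨a, ha7, hβa⟩ := exists_big_of_nbig b hn
  by_cases hai : a = i
  · subst hai; exact (not_big_designated b hi hshort hβa hd).elim
  have ha : a ∈ (range 7).erase i := mem_erase.2 ⟨hai, ha7⟩
  have hcard : (((range 7).erase i).erase a).card = 5 := by
    rw [card_erase_of_mem ha, card_erase_of_mem hi]; rfl
  have h := card_le_pairFloors_of_units b hb hp hi (erase_subset _ _) (units_of_dLarge b hi ha hshort hβa hd)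
  rw [hcard] at h
  exact_mod_cast h

/-- **`2p ≤ d ∧ nbig ≥ 2 ⇒ N_p ≥ 6`.** -/
theorem six_le_pairFloors_of_dLarge (b : ℕ → ℤ) (hb : InPolytope b) (hp : 0 < p) {i : ℕ} (hi : i ∈ range 7)
    (hshort : ∀ k ∈ (range 7).erase i, b 0 - 2 * b (k + 1) < p) (hd : 2 * (p : ℤ) ≤ dOf b) (hn : 2 ≤ nbig b p) :
    6 ≤ pairFloors b p := by
  obtain ⟨a, ha7, a', ha7', hne, hβa, hβa'⟩ := exists_two_big_of_nbig b hn
  have hai : a ≠ i := fun e => not_big_designated b hi hshort (e ▸ hβa) hd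
  have hai' : a' ≠ i := fun e => not_big_designated b hi hshort (e ▸ hβa') hd
  have ha : a ∈ (range 7).erase i := mem_erase.2 ⟨hai, ha7⟩
  have ha' : a' ∈ (range 7).erase i := mem_erase.2 ⟨hai', ha7'⟩
  have hu := units_of_dLarge b hi ha hshort hβa hd
  have hu' := units_of_dLarge b hi ha' hshort hβa' hd
  have hall : ∀ k ∈ (range 7).erase i, (p : ℤ) ≤ b 0 - b (i + 1) - b (k + 1) := by
    intro k hk
    by_cases hka : k = a
    · subst hka; exact hu' k (mem_erase.2 ⟨hne, hk⟩)
    · exact hu k (mem_erase.2 ⟨hka, hk⟩)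
  have hcard : ((range 7).erase i).card = 6 := by rw [card_erase_of_mem hi]; rfl
  have h := card_le_pairFloors_of_units b hb hp hi subset_rfl hall
  rw [hcard] at h
  exact_mod_cast h

/-! ### The shape of the high band -/

/-- `lpBonus ≤ nbig`. -/
theorem lpBonus_le_nbig (b : ℕ → ℤ) (p : ℕ) : lpBonus b p ≤ nbig b p := by unfold lpBonus; exact min_le_left _ _

/-- `lpBonus ≤ [LP] + [2p ≤ d]`. -/
theorem lpBonus_le_lp_add (b : ℕ → ℤ) (p : ℕ) :
    lpBonus b p ≤ lpUnit b p + (if 2 * (p : ℤ) ≤ dOf b then 1 else 0) := by unfold lpBonus; exact min_le_right _ _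

/-- **HIGH-BAND SHAPE:** `1 ≤ lpBonus` and `−3 ≤ −N_p + lpBonus` force `lpBonus = 1`, `N_p ≤ 4`, `[LP] = 1`. -/
theorem highBand_shape (b : ℕ → ℤ) (hb : InPolytope b) (hp : 0 < p) {i : ℕ} (hi : i ∈ range 7)
    (hshort : ∀ k ∈ (range 7).erase i, b 0 - 2 * b (k + 1) < p) (h1 : 1 ≤ lpBonus b p)
    (ht : -3 ≤ -pairFloors b p + lpBonus b p) : lpBonus b p = 1 ∧ pairFloors b p ≤ 4 ∧ lpUnit b p = 1 := by
  have hn := lpBonus_le_nbig b p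
  have hl := lpBonus_le_lp_add b p
  have hu1 := lpUnit_le_one b p
  have hu0 := lpUnit_nonneg b p
  have hind : (if 2 * (p : ℤ) ≤ dOf b then (1 : ℤ) else 0) ≤ 1 := by split_ifs <;> norm_num
  -- `lpBonus = 2` would force `2p ≤ d`, `nbig ≥ 2`, hence `N ≥ 6`
  have hone : lpBonus b p = 1 := by
    by_contra hne
    have h2 : lpBonus b p = 2 := by omega
    have hd : 2 * (p : ℤ) ≤ dOf b := by
      by_contra hd; rw [if_neg hd] at hl; omega
    have hn2 : 2 ≤ nbig b p := by exact_mod_cast (show (2 : ℤ) ≤ nbig b p by omega)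
    have := six_le_pairFloors_of_dLarge b hb hp hi hshort hd hn2
    omega
  refine ⟨hone, by omega, ?_⟩
  by_contra hlp
  have hlp0 : lpUnit b p = 0 := by omega
  have hd : 2 * (p : ℤ) ≤ dOf b := by
    by_contra hd; rw [if_neg hd] at hl; omega
  have hn1 : 1 ≤ nbig b p := by exact_mod_cast (show (1 : ℤ) ≤ nbig b p by omega)
  have := five_le_pairFloors_of_dLarge b hb hp hi hshort hd hn1
  omega

/-- **THE LP PARTNER:** `[LP] = 1` with short blocks off `i` gives a long designated block and a partner `k ≠ i` with `b_k ≥ p`,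
`b₀ − b_i − b_k ≥ p`. -/
theorem lp_partner (b : ℕ → ℤ) {i : ℕ} (hshort : ∀ k ∈ (range 7).erase i, b 0 - 2 * b (k + 1) < p) (hlp : lpUnit b p = 1) :
    (p : ℤ) ≤ b 0 - 2 * b (i + 1) ∧
      ∃ k ∈ (range 7).erase i, (p : ℤ) ≤ b (k + 1) ∧ (p : ℤ) ≤ b 0 - b (i + 1) - b (k + 1) := by
  unfold lpUnit at hlp
  split_ifs at hlp with h
  · obtain ⟨i', hi', k, hk, hne, hlong, hβk, hA⟩ := h
    have hii : i' = i := by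
      by_contra hne'
      have := hshort i' (mem_erase.2 ⟨hne', hi'⟩)
      omega
    subst hii
    exact ⟨hlong, k, mem_erase.2 ⟨fun e => hne e.symm, hk⟩, hβk, hA⟩
  · exact absurd hlp (by norm_num)

end Summit.KontsevichZagierPeriods.Zeta5Search.ClusterValuation

end
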